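import Summits.ValiantsHypothesis.ValiantsHypothesis.Theorems.KPlusLogSqLawTropicalBIntervalOpt
import Summits.ValiantsHypothesis.ValiantsHypothesis.Theorems.KPlusLogSqLawTropicalBSplitDefs

/-!
# Route «KPlusLogSqLaw», crux `TropicalB` (stmt-ValiantsHypothesis-19771) — the BOARD LAW for chains on four classes:
# a dominant chain using four classes has at most `m + 1` terms per BOARD of a class pair, hence `n + 1 ≤ (m+1) · #boards`

HONEST FRAMING.  Helper toward the registered stubs `stub_tropThin` / `stub_tropFat` of `Cruxes/TropicalB/Lines/birth.lean` (crux
`Summit.ValiantsHypothesis.ValiantsHypothesis.Theses.KPlusLogSqLaw.TropicalB`, item stmt-ValiantsHypothesis-19771, route KPlusLogSqLaw;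
cell `pub-symmetroid`, seat val-sym-trop-p3 g18, 2026-08-29; `--supports … --as helper`).  A STRUCTURE law for dominant chains of an
ARBITRARY design (any format, any exponents, any valuations, any support) whose terms use at most four classes — the currency of the
cell's `K = 4` fork («is `T(m,4)` quadratic or cubic», `TropicalCensus.TropK4Law`).  It bounds nothing for `TropicalB` in its window
and bears on neither `WeakLifting`, DoorA26 / DoorA34, `MatrixDescartes` (stmt-ValiantsHypothesis-18050) nor VP ≠ VNP.

THE LAW.  Fix two classes `a, b` (the «low pair»); the other two classes `c, e` used by the chain are the «high pair».  The BOARD of a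
term `q = (σ, λ)` is the pair (set `T` of columns carrying class `a` or `b`, its row image `σ(T)`).  Along a chain `p₀, …, pₙ` of unique
optima at strictly increasing integer slopes with consecutive terms distinct:
* `BoardLaw.card_filter_board_le` — **at most `m + 1` terms of the chain have any given board.**  Proof: two terms with the same board
  `(T, R)` agree on the images of `T` and of `Tᶜ`, so by the restricted-optimum comparison of the Gusfield toolkit
  (`IntervalOpt.sl_le_of_inOpt`, val-sym-trop-p5) their `T`-slopes AND their `Tᶜ`-slopes are weakly increasing in time, while the total
  slope strictly increases (`slope_strictMono_of_chainD`); the pairs (`T`-slope, `Tᶜ`-slope) therefore form a chain in a product of two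
  value sets of sizes `≤ #T + 1` and `≤ m − #T + 1` (two classes on each side), and a chain in `A × B` has at most `#A + #B − 1` elements
  (`card_chain_le_pred`, the tree's `IntervalOpt.card_chain_le` sharpened by one).
* `BoardLaw.succ_le_mul_card_boards` — **`n + 1 ≤ (m + 1) · #{boards visited}`**; `BoardLaw.succ_le_of_board_const` — a chain all of
  whose terms have the same board (the low-pair cells keep their column set and row set) has `n ≤ m` (SHARP: a two-class design has one
  board and `T(m,2) = m`).  LOCATED (seat tools on the tree certificates): the per-board maximum `m + 1` is ATTAINED in every kernel `K = 4`
  cell checked — tight `(5,4)` (6 terms on one board, 25 boards for the pair {0,1}), GRW-lite `(6,4)`/`(7,4)` (7 / 8), fast-digit `(4,4)` (5).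

READING (located, nothing claimed).  For the fork: a cubic `(m,4)` family must move the ROWS OR COLUMNS occupied by each class pair
through `Ω(m²)` distinct boards — the third digit cannot be carried by re-matchings inside a fixed low board and a fixed high board
(those are linear), it has to keep changing which rows/columns the two class pairs occupy.  [this cell; the comparison lemmas are the
tree's `…TropicalBIntervalOpt` (folklore: convexity of restricted upper envelopes)]
-/

set_option linter.dupNamespace false
set_option autoImplicit false

namespace Summit.ValiantsHypothesis.ValiantsHypothesis.Theorems.KPlusLogSqLaw

open Summit.ValiantsHypothesis.ValiantsHypothesis.Theorems.MatrixDescartes.Negative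
open Summit.ValiantsHypothesis.ValiantsHypothesis.Theorems.LacunarySymmetroidMatrixDescartes
open scoped BigOperators
open Finset

namespace BoardLaw

variable {m K : ℕ}

/-- the `J`-slope of a term whose classes on `J` lie in `{a, b}` is `#J·d a + j·(d b − d a)` for some `j ≤ #J`. [folklore] -/
theorem sl_mem_image_of_two (d : Fin K → ℕ) (a b : Fin K) (J : Finset (Fin m))
    (q : Equiv.Perm (Fin m) × (Fin m → Fin K)) (h : ∀ i ∈ J, q.2 i = a ∨ q.2 i = b) :
    IntervalOpt.sl d J q ∈ (range (J.card + 1)).image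
      (fun j : ℕ => (J.card : ℤ) * d a + (j : ℤ) * ((d b : ℤ) - d a)) := by
  classical
  unfold IntervalOpt.sl
  set j := (J.filter fun i => q.2 i ≠ a).card with hj
  refine mem_image.2 ⟨j, ?_, ?_⟩
  · rw [mem_range, Nat.lt_succ_iff, hj]
    exact card_le_card (filter_subset _ _)
  · have hsplit := sum_filter_add_sum_filter_not J (fun i => q.2 i = a) (fun i => (d (q.2 i) : ℤ))
    have h1 : ∑ i ∈ J.filter (fun i => q.2 i = a), (d (q.2 i) : ℤ) =
        ((J.filter fun i => q.2 i = a).card : ℤ) * d a := by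
      rw [sum_congr rfl (fun i hi => by rw [(mem_filter.1 hi).2] : ∀ i ∈ J.filter (fun i => q.2 i = a),
        (d (q.2 i) : ℤ) = d a), sum_const, nsmul_eq_mul]
    have h2 : ∑ i ∈ J.filter (fun i => ¬ q.2 i = a), (d (q.2 i) : ℤ) =
        ((J.filter fun i => ¬ q.2 i = a).card : ℤ) * d b := by
      rw [sum_congr rfl (fun i hi => ?_ : ∀ i ∈ J.filter (fun i => ¬ q.2 i = a), (d (q.2 i) : ℤ) = d b),
        sum_const, nsmul_eq_mul]
      obtain ⟨hiJ, hia⟩ := mem_filter.1 hi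
      rcases h i hiJ with hq | hq
      · exact absurd hq hia
      · rw [hq]
    have hcard := card_filter_add_card_filter_not (s := J) (fun i => q.2 i = a)
    have hj' : (J.filter fun i => ¬ q.2 i = a).card = j := by rw [hj]
    rw [← hsplit, h1, h2, hj']
    have : ((J.filter fun i => q.2 i = a).card : ℤ) = (J.card : ℤ) - j := by
      rw [← hcard, hj']; push_cast; ring
    rw [this]; ring

/-- that value set has at most `#J + 1` elements. [folklore] -/
theorem card_image_two_le (d : Fin K → ℕ) (a b : Fin K) (J : Finset (Fin m)) :
    ((range (J.card + 1)).image (fun j : ℕ => (J.card : ℤ) * d a + (j : ℤ) * ((d b : ℤ) - d a))).card ≤ J.card + 1 :=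
  card_image_le.trans (card_range _).le

/-- a permutation maps the complement of `J` onto the complement of the image of `J`. [folklore] -/
theorem image_compl_perm (σ : Equiv.Perm (Fin m)) (J : Finset (Fin m)) : Jᶜ.image σ = (J.image σ)ᶜ := by
  classical
  ext x
  simp only [mem_image, mem_compl]
  constructor
  · rintro ⟨i, hi, rfl⟩ ⟨i', hi', h⟩
    exact hi (σ.injective h ▸ hi')
  · intro h
    exact ⟨σ.symm x, fun hx => h ⟨σ.symm x, hx, σ.apply_symm_apply x⟩, σ.apply_symm_apply x⟩

/-- `T`-slope plus `Tᶜ`-slope is the total slope. [folklore] -/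
theorem sl_add_sl_compl (d : Fin K → ℕ) (J : Finset (Fin m)) (q : Equiv.Perm (Fin m) × (Fin m → Fin K)) :
    IntervalOpt.sl d J q + IntervalOpt.sl d Jᶜ q = TropicalCensus.slope d q := by
  unfold IntervalOpt.sl TropicalCensus.slope
  exact sum_add_sum_compl J fun i => (d (q.2 i) : ℤ)

/-- **A chain inside `A × B` has at most `#A + #B − 1` elements** (sharpening of `IntervalOpt.card_chain_le` by one: the rank-sum
`#{a ∈ A | a < y.1} + #{b ∈ B | b < y.2}` of a chain element is at most `(#A − 1) + (#B − 1)`). [folklore] -/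
theorem card_chain_le_pred (A B : Finset ℤ) (Y : Finset (ℤ × ℤ)) (hA : ∀ y ∈ Y, y.1 ∈ A) (hB : ∀ y ∈ Y, y.2 ∈ B)
    (hch : ∀ y ∈ Y, ∀ y' ∈ Y, y ≠ y' → (y.1 ≤ y'.1 ∧ y.2 ≤ y'.2) ∨ (y'.1 ≤ y.1 ∧ y'.2 ≤ y.2)) :
    Y.card ≤ A.card + B.card - 1 := by
  classical
  let ψ : ℤ × ℤ → ℕ := fun y => (A.filter (· < y.1)).card + (B.filter (· < y.2)).card
  have hmono : ∀ y ∈ Y, ∀ y' ∈ Y, y ≠ y' → y.1 ≤ y'.1 → y.2 ≤ y'.2 → ψ y < ψ y' := by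
    intro y hy y' _ hne h1 h2
    have s1 : A.filter (· < y.1) ⊆ A.filter (· < y'.1) := by
      intro x hx
      rw [Finset.mem_filter] at hx ⊢
      exact ⟨hx.1, lt_of_lt_of_le hx.2 h1⟩
    have s2 : B.filter (· < y.2) ⊆ B.filter (· < y'.2) := by
      intro x hx
      rw [Finset.mem_filter] at hx ⊢
      exact ⟨hx.1, lt_of_lt_of_le hx.2 h2⟩
    have hne' : y.1 ≠ y'.1 ∨ y.2 ≠ y'.2 := by
      by_contra h
      push Not at h
      exact hne (Prod.ext h.1 h.2)
    rcases hne' with h | h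
    · have hlt : y.1 < y'.1 := lt_of_le_of_ne h1 h
      have hss : A.filter (· < y.1) ⊂ A.filter (· < y'.1) := by
        refine (Finset.ssubset_iff_of_subset s1).2 ⟨y.1, ?_, ?_⟩
        · rw [Finset.mem_filter]; exact ⟨hA y hy, hlt⟩
        · rw [Finset.mem_filter]; exact fun hh => lt_irrefl _ hh.2
      have c1 := Finset.card_lt_card hss
      have c2 := Finset.card_le_card s2
      simp only [ψ]; omega
    · have hlt : y.2 < y'.2 := lt_of_le_of_ne h2 h
      have hss : B.filter (· < y.2) ⊂ B.filter (· < y'.2) := by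
        refine (Finset.ssubset_iff_of_subset s2).2 ⟨y.2, ?_, ?_⟩
        · rw [Finset.mem_filter]; exact ⟨hB y hy, hlt⟩
        · rw [Finset.mem_filter]; exact fun hh => lt_irrefl _ hh.2
      have c1 := Finset.card_lt_card hss
      have c2 := Finset.card_le_card s1
      simp only [ψ]; omega
  have hinj : Set.InjOn ψ Y := by
    intro y hy y' hy' heq
    by_contra hne
    rcases hch y hy y' hy' hne with ⟨h1, h2⟩ | ⟨h1, h2⟩
    · exact absurd heq (hmono y hy y' hy' hne h1 h2).ne
    · exact absurd heq.symm (hmono y' hy' y hy (Ne.symm hne) h1 h2).ne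
  have hbound : ∀ y ∈ Y, ψ y < A.card + B.card - 1 := by
    intro y hy
    have hsA : A.filter (· < y.1) ⊂ A := by
      refine (Finset.ssubset_iff_of_subset (Finset.filter_subset _ _)).2 ⟨y.1, hA y hy, ?_⟩
      rw [Finset.mem_filter]; exact fun hh => lt_irrefl _ hh.2
    have hsB : B.filter (· < y.2) ⊂ B := by
      refine (Finset.ssubset_iff_of_subset (Finset.filter_subset _ _)).2 ⟨y.2, hB y hy, ?_⟩
      rw [Finset.mem_filter]; exact fun hh => lt_irrefl _ hh.2
    have c1 := Finset.card_lt_card hsA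
    have c2 := Finset.card_lt_card hsB
    simp only [ψ]; omega
  calc Y.card = (Y.image ψ).card := (Finset.card_image_of_injOn hinj).symm
    _ ≤ (Finset.range (A.card + B.card - 1)).card := by
        refine Finset.card_le_card fun n hn => ?_
        obtain ⟨y, hy, rfl⟩ := Finset.mem_image.1 hn
        exact Finset.mem_range.2 (hbound y hy)
    _ = A.card + B.card - 1 := Finset.card_range _

section Chain

variable (d : Fin K → ℕ) (v ε : Fin m → Fin m → Fin K → ℤ) {n : ℕ} (θ : Fin (n + 1) → ℤ)
  (p : Fin (n + 1) → Equiv.Perm (Fin m) × (Fin m → Fin K))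

/-- **BOARD LAW (fibre form).**  Along a dominant chain (strictly increasing integer slopes, consecutive terms distinct) whose terms use only
the four classes `a, b, c, e`, at most `m + 1` terms have a given board of the pair `{a, b}` — i.e. a given set `T` of columns of class `a`
or `b` together with a given row image of `T`. [this cell] -/
theorem card_filter_board_le (hθ : StrictMono θ) (hdom : ∀ k, IsDominant d v ε (θ k) (p k))
    (hne : ∀ k : Fin n, p k.castSucc ≠ p k.succ) (a b c e : Fin K)
    (hcov : ∀ k i, (p k).2 i = a ∨ (p k).2 i = b ∨ (p k).2 i = c ∨ (p k).2 i = e)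
    (β : Finset (Fin m) × Finset (Fin m)) :
    (univ.filter fun k => ((univ.filter fun i => (p k).2 i = a ∨ (p k).2 i = b),
        (univ.filter fun i => (p k).2 i = a ∨ (p k).2 i = b).image (p k).1) = β).card ≤ m + 1 := by
  classical
  set T : Fin (n + 1) → Finset (Fin m) := fun k => univ.filter fun i => (p k).2 i = a ∨ (p k).2 i = b with hT
  set F := univ.filter fun k => (T k, (T k).image (p k).1) = β with hF
  show F.card ≤ m + 1
  obtain ⟨T₀, R₀⟩ := β
  -- members of the fibre: their `{a,b}`-columns are `T₀` with row image `R₀`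
  have hmem : ∀ k ∈ F, T k = T₀ ∧ T₀.image (p k).1 = R₀ := by
    intro k hk
    have h := (mem_filter.1 hk).2
    rw [Prod.mk.injEq] at h
    exact ⟨h.1, h.1 ▸ h.2⟩
  have hlow : ∀ k ∈ F, ∀ i ∈ T₀, (p k).2 i = a ∨ (p k).2 i = b := by
    intro k hk i hi
    rw [← (hmem k hk).1] at hi
    exact (mem_filter.1 hi).2
  have hhigh : ∀ k ∈ F, ∀ i ∈ T₀ᶜ, (p k).2 i = c ∨ (p k).2 i = e := by
    intro k hk i hi
    rw [mem_compl, ← (hmem k hk).1] at hi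
    have hi' : ¬ ((p k).2 i = a ∨ (p k).2 i = b) := fun h => hi (mem_filter.2 ⟨mem_univ _, h⟩)
    rcases hcov k i with h | h | h | h
    · exact absurd (Or.inl h) hi'
    · exact absurd (Or.inr h) hi'
    · exact Or.inl h
    · exact Or.inr h
  -- restricted optima on `T₀` and on `T₀ᶜ`, with common images inside the fibre
  have hopt : ∀ k (J : Finset (Fin m)), IntervalOpt.InOpt d v ε J (θ k) (p k) := fun k J =>
    IntervalOpt.inOpt_mono (subset_univ J) (IntervalOpt.inOpt_univ_of_isDominant (hdom k))
  have himgT : ∀ k ∈ F, ∀ k' ∈ F, T₀.image (p k).1 = T₀.image (p k').1 := fun k hk k' hk' => by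
    rw [(hmem k hk).2, (hmem k' hk').2]
  have himgC : ∀ k ∈ F, ∀ k' ∈ F, T₀ᶜ.image (p k).1 = T₀ᶜ.image (p k').1 := fun k hk k' hk' => by
    rw [image_compl_perm, image_compl_perm, himgT k hk k' hk']
  have hmono : ∀ k ∈ F, ∀ k' ∈ F, k ≤ k' →
      IntervalOpt.sl d T₀ (p k) ≤ IntervalOpt.sl d T₀ (p k') ∧ IntervalOpt.sl d T₀ᶜ (p k) ≤ IntervalOpt.sl d T₀ᶜ (p k') :=
    fun k hk k' hk' hkk' =>
      ⟨IntervalOpt.sl_le_of_inOpt (hopt k T₀) (hopt k' T₀) (himgT k hk k' hk') (hθ.monotone hkk'),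
       IntervalOpt.sl_le_of_inOpt (hopt k T₀ᶜ) (hopt k' T₀ᶜ) (himgC k hk k' hk') (hθ.monotone hkk')⟩
  -- the pair of partial slopes is injective on the fibre (the total slope strictly increases)
  set g : Fin (n + 1) → ℤ × ℤ := fun k => (IntervalOpt.sl d T₀ (p k), IntervalOpt.sl d T₀ᶜ (p k)) with hg
  have hslope := slope_strictMono_of_chainD d v ε θ p hθ hdom hne
  have hinj : Set.InjOn g F := by
    intro k _ k' _ hkk'
    have h1 : IntervalOpt.sl d T₀ (p k) = IntervalOpt.sl d T₀ (p k') := congrArg Prod.fst hkk'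
    have h2 : IntervalOpt.sl d T₀ᶜ (p k) = IntervalOpt.sl d T₀ᶜ (p k') := congrArg Prod.snd hkk'
    apply hslope.injective
    show TropicalCensus.slope d (p k) = TropicalCensus.slope d (p k')
    rw [← sl_add_sl_compl d T₀ (p k), ← sl_add_sl_compl d T₀ (p k'), h1, h2]
  -- the image is a chain in `A × B`
  set A := (range (T₀.card + 1)).image (fun j : ℕ => (T₀.card : ℤ) * d a + (j : ℤ) * ((d b : ℤ) - d a)) with hA
  set B := (range (T₀ᶜ.card + 1)).image (fun j : ℕ => (T₀ᶜ.card : ℤ) * d c + (j : ℤ) * ((d e : ℤ) - d c)) with hB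
  have hY := card_chain_le_pred A B (F.image g)
    (fun y hy => by
      obtain ⟨k, hk, rfl⟩ := mem_image.1 hy
      exact sl_mem_image_of_two d a b T₀ (p k) (hlow k hk))
    (fun y hy => by
      obtain ⟨k, hk, rfl⟩ := mem_image.1 hy
      exact sl_mem_image_of_two d c e T₀ᶜ (p k) (hhigh k hk))
    (fun y hy y' hy' _ => by
      obtain ⟨k, hk, rfl⟩ := mem_image.1 hy
      obtain ⟨k', hk', rfl⟩ := mem_image.1 hy'
      rcases le_total k k' with hkk' | hkk'
      · exact Or.inl (hmono k hk k' hk' hkk')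
      · exact Or.inr (hmono k' hk' k hk hkk'))
  have hcA := card_image_two_le d a b T₀
  have hcB := card_image_two_le d c e T₀ᶜ
  have hcc : T₀ᶜ.card = m - T₀.card := by rw [card_compl, Fintype.card_fin]
  have hTm : T₀.card ≤ m := (card_le_univ T₀).trans (Fintype.card_fin m).le
  rw [← card_image_of_injOn hinj]
  calc (F.image g).card ≤ A.card + B.card - 1 := hY
    _ ≤ (T₀.card + 1) + (T₀ᶜ.card + 1) - 1 := Nat.sub_le_sub_right (Nat.add_le_add hcA hcB) 1
    _ = m + 1 := by rw [hcc]; omega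

/-- **BOARD LAW.**  A dominant chain on four classes `a, b, c, e` (strictly increasing integer slopes, consecutive terms distinct) has
`n + 1 ≤ (m + 1) · N`, where `N` is the number of distinct boards of the pair `{a, b}` (column set of the `{a,b}`-cells and its row image)
visited by the chain. [this cell] -/
theorem succ_le_mul_card_boards (hθ : StrictMono θ) (hdom : ∀ k, IsDominant d v ε (θ k) (p k))
    (hne : ∀ k : Fin n, p k.castSucc ≠ p k.succ) (a b c e : Fin K)
    (hcov : ∀ k i, (p k).2 i = a ∨ (p k).2 i = b ∨ (p k).2 i = c ∨ (p k).2 i = e) :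
    n + 1 ≤ (m + 1) * (univ.image fun k : Fin (n + 1) => ((univ.filter fun i => (p k).2 i = a ∨ (p k).2 i = b),
        (univ.filter fun i => (p k).2 i = a ∨ (p k).2 i = b).image (p k).1)).card := by
  classical
  set brd : Fin (n + 1) → Finset (Fin m) × Finset (Fin m) := fun k => ((univ.filter fun i => (p k).2 i = a ∨ (p k).2 i = b),
        (univ.filter fun i => (p k).2 i = a ∨ (p k).2 i = b).image (p k).1) with hbrd
  have hfib : ∀ β ∈ univ.image brd, (univ.filter fun k => brd k = β).card ≤ m + 1 := fun β _ =>
    card_filter_board_le d v ε θ p hθ hdom hne a b c e hcov β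
  have hsum := card_eq_sum_card_image brd (univ : Finset (Fin (n + 1)))
  have hle : ∑ β ∈ univ.image brd, (univ.filter fun k => brd k = β).card ≤ (univ.image brd).card * (m + 1) :=
    (sum_le_card_nsmul _ _ _ hfib).trans (by rw [smul_eq_mul])
  have hcard : (univ : Finset (Fin (n + 1))).card = n + 1 := by rw [card_univ, Fintype.card_fin]
  calc n + 1 = (univ : Finset (Fin (n + 1))).card := hcard.symm
    _ = ∑ β ∈ univ.image brd, (univ.filter fun k => brd k = β).card := hsum
    _ ≤ (univ.image brd).card * (m + 1) := hle
    _ = (m + 1) * (univ.image brd).card := mul_comm _ _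

/-- **Fixed board ⇒ `n ≤ m`** (sharp: `K = 2`).  If all terms of such a chain have the same `{a,b}`-board, then `n ≤ m`. [this cell] -/
theorem succ_le_of_board_const (hθ : StrictMono θ) (hdom : ∀ k, IsDominant d v ε (θ k) (p k))
    (hne : ∀ k : Fin n, p k.castSucc ≠ p k.succ) (a b c e : Fin K)
    (hcov : ∀ k i, (p k).2 i = a ∨ (p k).2 i = b ∨ (p k).2 i = c ∨ (p k).2 i = e)
    (hconst : ∀ k, ((univ.filter fun i => (p k).2 i = a ∨ (p k).2 i = b),
        (univ.filter fun i => (p k).2 i = a ∨ (p k).2 i = b).image (p k).1) =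
      ((univ.filter fun i => (p 0).2 i = a ∨ (p 0).2 i = b),
        (univ.filter fun i => (p 0).2 i = a ∨ (p 0).2 i = b).image (p 0).1)) :
    n ≤ m := by
  classical
  have h := card_filter_board_le d v ε θ p hθ hdom hne a b c e hcov
    ((univ.filter fun i => (p 0).2 i = a ∨ (p 0).2 i = b),
      (univ.filter fun i => (p 0).2 i = a ∨ (p 0).2 i = b).image (p 0).1)
  have hall : (univ.filter fun k => ((univ.filter fun i => (p k).2 i = a ∨ (p k).2 i = b),
        (univ.filter fun i => (p k).2 i = a ∨ (p k).2 i = b).image (p k).1) =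
      ((univ.filter fun i => (p 0).2 i = a ∨ (p 0).2 i = b),
        (univ.filter fun i => (p 0).2 i = a ∨ (p 0).2 i = b).image (p 0).1)) = univ :=
    filter_true_of_mem fun k _ => hconst k
  rw [hall, card_univ, Fintype.card_fin] at h
  omega

end Chain

end BoardLaw

end Summit.ValiantsHypothesis.ValiantsHypothesis.Theorems.KPlusLogSqLaw
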